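import Literature.IUT.HodgeTheaters.Cor53iFcircBijectiveAtIdCarrier
import HarnessLib

/-!
# Layer-5 certificate v0.26 — BLOCK J over a BUILT Literature module only: [IUTchI] Cor 5.3 (i) «respectively `⊚`» AS PRINTED
# («bijective») at the LITERAL identity carrier `toBase0 := 𝟭 (ℬ(G_F)⁰)` — modulo the NAMED FACT {`NeukirchUchida F`} ONLY
# (abc-iut-L5-lead gen 11 RULINGS #196 (1) «V26 one-conjunct display of FILE C … pre-approved after C ✓»; CERT-L5 R73 holder
# abc-iut-L5-t16 gen 13; plan/L5/LAYER5-CERT-SPEC.md §7)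

PROOF-ONLY (no `def`, no `instance`, no `axiom`, no `sorry`, no `notation`); NO `Conditional` import (architecture-neutral).  The one
theorem is a landed Literature theorem VERBATIM (section variables spelled in), proof BY NAME — one call, from abc-iut-L5-t4's ★ p548756
`Cor53iFcircBijectiveAtIdCarrier` (FILE C, row «BIJECTIVE@IDCARRIER mod NU»: at every EQUIVALENCE carrier of `G_F` the descent law
`hdesc⊚` HOLDS, hence abc-iut-w4-d109's `hlift⊚` by name, hence «bijective» from ★ p542877 `Cor53.fcirc_descendBijective_of_galoisRich_of_lifts`
with `hS` inhabited by ★ p545785):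
* (C-53i⊚-bij@𝟭) `layer5_disch_cor53i_v26_fcirc_descendBijective_idFunctor (F) (hNU) (𝓕)` :=
  `Cor53.fcirc_descendBijective_idFunctor_of_neukirchUchida`: for EVERY record `𝓕 : GlobalFrobenioid (arith F) (ℬ(G_F)⁰) (𝟭 _)` the
  descent map `Aut(†ℱ^⊚) → Aut(†𝒟^⊚)` is BIJECTIVE («bijective» as printed in [IUTchI] Cor 5.3 (i), resp. `⊚`, at `H := G_F`,
  `toBase0 := 𝟭`) — DISPLAYED binder exactly {`hNU : NeukirchUchida F`} (FACT, BY NAME: [NSW] Thm (12.2.1)); LAW ∅; `hZ` is discharged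
  inside (`G_F` slim, ★ `isSlimGroup_absGalGrp`), `hS` / `hB⊚` / `hdesc⊚` / `hlift⊚` are discharged inside (FILE C §1–§3 over ★ p545785,
  ★ p542877 and abc-iut-w4-d109's ★ `liftsAll_fcircBase_arith_of_desc_of_neukirchUchida`).
HONEST NOTE (RULINGS #173 (3) / #193 (1), of record): at a DEGENERATE `toBase0` hB⊚ is refutable-as-typed and `hS` is EMPTY
(abc-iut-L5-t11's face file); at a GENERAL push carrier `ι : H →* G_F` with `ι(H) ≠ G_F` «bijective» stays modulo {`hlift⊚`} (no witness
filed either way); the identity carrier is OUR model of `†𝒟^⊚ = †𝒟^⊛`.  CENSUS delta for §7 (the lead's booking): display: +1 conjunct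
(C-53i⊚-bij@𝟭) with binder set {hNU} (FACT, already counted via (C-53i⊛) at v0.23); CONE/FACT otherwise unchanged; tokens none.
S. Mochizuki, *Inter-universal Teichmüller theory I* [cite: Mochizuki2012] (D-0012 claim key; series status DISPUTED): Cor 5.3 (i) p. 144;
Ex 5.1 (iii)/(v) pp. 125–128.  HONEST FRAMING: a CERT conjunct DISPLAYS its binders, it does not discharge them; `NeukirchUchida F` is a
NAMED FACT, unproved in the tree; nothing here asserts that abc is proved or refuted or takes a side on [IUTchIII] Cor. 3.12;
typed ≠ inhabited ≠ discharged; indexed ≠ endorsed.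
-/

namespace Summit.ABC.IUTFork.Conditional

open CategoryTheory Opposite Literature.IUT.HodgeTheaters
open Literature.AnabelianGeometry.SemiGraphs Literature.AlgebraicGeometry.Frobenioids
open Literature.AlgebraicGeometry.Frobenioids.QuasiTemperoid Literature.NumberTheory.GaloisRepresentations

noncomputable section BlocksJV26

/-- **(C-53i⊚-bij@𝟭) [IUTchI] Cor 5.3 (i) «resp. `⊚`» AS PRINTED («bijective») at the literal identity carrier `toBase0 := 𝟭 (ℬ(G_F)⁰)`,
for EVERY record, modulo {`NeukirchUchida F`} ONLY** := abc-iut-L5-t4's ★ `Cor53.fcirc_descendBijective_idFunctor_of_neukirchUchida`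
(p548756).  DISPLAYED binder exactly {`hNU`}; injectivity alone is `(this …).1` and needs no hypothesis at this carrier
(★ `Cor53.fcirc_rigidOverBase_of_toBase0_isEquivalence`). [cite: Mochizuki2012, IUTchI Cor 5.3 (i) p.144] [claim: Mochizuki2012, status: disputed] -/
theorem layer5_disch_cor53i_v26_fcirc_descendBijective_idFunctor (F : Type) [Field F] [NumberField F] (hNU : NeukirchUchida F)
    (𝓕 : GlobalFrobenioid (GlobalDivisorData.arith F) (BaseCat (absGalGrp F)) (𝟭 (BaseCat (absGalGrp F)))) :
    CatIsomorphism.DescendBijective 𝓕.fcircBase 𝓕.fcircBase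
      (GlobalFrobenioid.hasUnder_and_underUnique_fcircBase_arith_baseCat 𝓕 𝓕 (isSlimGroup_absGalGrp F) (isSlimGroup_absGalGrp F)).1
      (GlobalFrobenioid.hasUnder_and_underUnique_fcircBase_arith_baseCat 𝓕 𝓕 (isSlimGroup_absGalGrp F) (isSlimGroup_absGalGrp F)).2 :=
  Cor53.fcirc_descendBijective_idFunctor_of_neukirchUchida F hNU 𝓕

end BlocksJV26

end Summit.ABC.IUTFork.Conditional

/-! ### Build-lane export guard (ops-buildfix bf1-g30, 2026-08-28; G11b-3 recipe v2 as in `GelbartRogawski1991/UnitaryDualPairSeesawCharacter`):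
the theorems of this file carry very large dependent telescopes; at `.olean` export Lean 4.32's library-suggestion indexers fold over
every local theorem statement and do not finish within the build lane's one-hour clock (measured on a farm node: `lean -o` > 1 500 s, plain
elaboration ≈ 20 s). ONE file-final `local` `[implicit_reducible]` keeps them out of that premise index (inert for Meta and the kernel on
theorems; no definition is tagged; statements and proofs unchanged). -/
set_option allowUnsafeReducibility true in
attribute [local implicit_reducible]
  _root_.Summit.ABC.IUTFork.Conditional.layer5_disch_cor53i_v26_fcirc_descendBijective_idFunctor
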